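import Summits.HodgeConjecture.HodgeConjecture.Theses.VHCAbelianSchemesRoad
import Summits.HodgeConjecture.HodgeConjecture.Theorems.VHCAbelianSchemesRoadSecantQuotientAnchorPinnedDefsPrime
import Summits.HodgeConjecture.HodgeConjecture.Theorems.VHCAbelianSchemesRoadSecantQuotientResidualExceptionalCarriers
import Summits.HodgeConjecture.HodgeConjecture.Theorems.VHCAbelianSchemesRoadSecantQuotientAnchorSameAnchorTransferDefs
import Summits.HodgeConjecture.HodgeConjecture.Theorems.VHCAbelianSchemesRoadSecantQuotientPinnedLevelTransferDefs
import HarnessLib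

/-!
# Road b02 (`VHCAbelianSchemesRoad`) — THE PRIMED DIAGONAL CRUX FROM ITS CELLS, BY NAME
# (item stmt-HodgeConjecture-20707 `SemiregularSheafRepresentativesTwPrimeAtDiag`, registered skeleton v3.3 `Cruxes/…TwPrimeAtDiag/Lines/birth.lean` sha16 ba3c7cae8f05833c)

research route conditional on HC_CM; not a corollary; Q11.4-sentence-2 already refuted in dim ≥ 3.

FACT-FREE COMPOSITION, NO DEFINITION, NOTHING CLOSED (`HC_CM` nowhere; every input is a HYPOTHESIS). Ring-2 LEAD 159's kernel-side composition check
(`CompositionCheckG159c.lean` md5 c94496314e104b3d12d52047c68ce544 ∕ variant d, 2026-08-27, director-hodge g10 R10.4 (6′)(b); ring2 INBOX l.5292 ∕ l.5302) LANDED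
AS A TREE HELPER (ring2-b06 g125, the one sugar item of director-hodge g10 l.5300 (c)), because the registered skeleton module under `Cruxes/` is not importable:

* §0 `twPrimeAtDiag_of_cells` — the skeleton's own fact-free composition (v3.3 ll. 82–96) VERBATIM over tree names, in the road namespace: first cell `(4,2)`,
  the `(6,3)` rung statement `LefAtExceptionalRegimeSixfoldMiddle (tw C AdmTw′)`, the tail `4 ≤ m` ⟹ regime 2 at every diagonal cell `(2m, m)`, `2 ≤ m`, i.e. the
  ROUTE DECL `Theses.VHCAbelianSchemesRoad.SemiregularSheafRepresentativesTwPrimeAtDiag` unfolded (§3 folds it BY NAME).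
* §1 the lanes' two junctions have EXACTLY the registered `(6,3)` stub types (syntactic guards): stub 2a‴ `∀ C, SecantQuotientAnchorCarrier63PinnedPrime C` ⟸
  L1″(C, AdmTw′) ∧ G1′ ∧ G3′ (`forall_secantQuotientAnchorCarrier63PinnedPrime_of_pinned_of_levelTransfer63_of_sameAnchorTransfer63`, ring2-b03x g3 p564286) and ⟸
  L1″ ∧ G1♭′ ∧ G3′ (`secantQuotientAnchorCarrier63PinnedPrime_of_pinned_of_pinnedLevelTransfer_of_sameAnchor`, ring2-b03 g87 p566937); stub 2b‴
  `∀ C, SecantQuotientResidual63PinnedPrime C` ⟸ W-restricted elliptic-power carriers ∧ the doubly residual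
  (`forall_secantQuotientResidual63PinnedPrime_of_ellipticPowerExceptionalCarriersAt63_of_under_not_not`, ring2-b03 g86 p562855).
* §2 the primed `(6,3)` RUNG from the five named ∕ displayed `(6,3)` inputs by the skeleton's own rung glue
  `rung_sixfoldMiddleTwPrime_of_secantQuotientAnchorCarrier63PinnedPrime_of_residual63PinnedPrime` (ring2-b06 g121 p547560), in both forms (G1′ and G1♭′).
* §3 SEVEN NAMED ∕ DISPLAYED INPUTS ⟹ THE ROUTE DECL BY NAME: stub 1′ (displayed) · L1″(C, AdmTw′) = `Markman2025_secantQuotient_twistedCarrier_onJacobian_pinned C AdmTw′`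
  (print, preprint-gated) · G1′ = `SecantQuotientAnchorLevelTransfer63PinnedPrime C` (lane R node, p561877) resp. G1♭′ = `SecantQuotientPinnedAnchorLevelTransfer63PinnedPrime C`
  (p566937) · G3′ = `SecantQuotientSameAnchorTransfer63PinnedPrime C` (lane W1 node, p564286) · W = `EllipticPowerExceptionalCarriersAt63TwPrime C` (p562855) ·
  DR = the doubly residual (displayed inline: no pinned-served secant–quotient fibre AND no elliptic-power fibre) · stub 3′ (displayed).

READING (words, not a claim): kernel-side the line's `(6,3)` cell is EXACTLY five OPEN named inputs {L1″, G1′ (or G1♭′), G3′, W-carriers, DR} plus the two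
XL research stubs 1′ ∕ 3′; the conclusion of §3 carries all seven as hypotheses (gate advisory `proof.conditional` expected; the type is NOT the route decl's closing
shape). Skeleton v3.3, the route's `closes`, every stub: UNTOUCHED. Nothing here says any input, stub, cell, rung, crux, VHC, `HC_AV`, `HC_CM` or HC holds.
References: [cite: Markman2025SecantWeil, Thm. 1.4.1, §1.5, Lemma 9.3.11 and Remark 9.3.7] [cite: Bloch1972Semiregularity, Remark (7.5)] [cite: BuchweitzFlenner2003, §4].
-/

noncomputable section

open CategoryTheory CategoryTheory.Limits AlgebraicGeometry Topology

-- the cell's namespace repeats the summit name (`Summit.HodgeConjecture.HodgeConjecture…`), as in every `Ring2*` ∕ road file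
namespace Summit.HodgeConjecture.HodgeConjecture.Ring2.SemiregularRepresentatives

set_option linter.dupNamespace false

open Literature.AlgebraicGeometry Literature.AlgebraicGeometry.Motives Literature.AlgebraicGeometry.Motives.AbelianVariety
open Literature.AlgebraicGeometry.HodgeTheory Literature.AlgebraicGeometry.Markman2025
open Literature.AlgebraicTopology.SingularHomology

/-! ## §0 the skeleton's fact-free composition (skeleton v3.3 ll. 82–96, verbatim) -/

/-- **BC3 composition, hypothesis form (primed), BY NAME in the road namespace** — the registered skeleton v3.3's `twPrimeAtDiag_of_cells`
(`Cruxes/SemiregularSheafRepresentativesTwPrimeAtDiag/Lines/birth.lean` ll. 82–96) verbatim: the three primed cell statements (first cell `(4,2)`,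
the `(6,3)` rung, the tail `4 ≤ m`) give regime 2 over the primed twisted door `tw(C, AdmTw′)`, `AdmTw′ = gluableSigmaAdmissible ∨ bfSingleAdmissible′`,
at every diagonal cell `(2m, m)`, `2 ≤ m` (case split on `m`). Fact-free; nothing asserted. -/
theorem twPrimeAtDiag_of_cells
    (h₁ : ∀ C : ChernCharacterBetti,
      LefAtExceptionalRegimeAt (Literature.AlgebraicGeometry.HodgeTheory.twistedReflexiveClass C (fun n X₀ I E => Summit.Ventures.HSemireg.gluableSigmaAdmissible n X₀ I E ∨ Literature.AlgebraicGeometry.HodgeTheory.bfSingleAdmissible' n X₀ I E)) 4 2)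
    (h₂ : ∀ C : ChernCharacterBetti,
      LefAtExceptionalRegimeSixfoldMiddle (Literature.AlgebraicGeometry.HodgeTheory.twistedReflexiveClass C (fun n X₀ I E => Summit.Ventures.HSemireg.gluableSigmaAdmissible n X₀ I E ∨ Literature.AlgebraicGeometry.HodgeTheory.bfSingleAdmissible' n X₀ I E)))
    (h₃ : ∀ (C : ChernCharacterBetti) (m : ℕ), 4 ≤ m →
      LefAtExceptionalRegimeAt (Literature.AlgebraicGeometry.HodgeTheory.twistedReflexiveClass C (fun n X₀ I E => Summit.Ventures.HSemireg.gluableSigmaAdmissible n X₀ I E ∨ Literature.AlgebraicGeometry.HodgeTheory.bfSingleAdmissible' n X₀ I E)) (2 * m) m) :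
    ∀ (C : ChernCharacterBetti) (m : ℕ), 2 ≤ m →
      LefAtExceptionalRegimeAt (Literature.AlgebraicGeometry.HodgeTheory.twistedReflexiveClass C (fun n X₀ I E => Summit.Ventures.HSemireg.gluableSigmaAdmissible n X₀ I E ∨ Literature.AlgebraicGeometry.HodgeTheory.bfSingleAdmissible' n X₀ I E)) (2 * m) m := by
  intro C m hm
  rcases Nat.lt_or_ge m 4 with hlt | hge
  · interval_cases m
    · exact h₁ C
    · exact (lefAtExceptionalRegimeSixfoldMiddle_iff_at.1 (h₂ C))
  · exact h₃ C m hge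

/-! ## §1 the two junctions have EXACTLY the registered `(6,3)` stub types (syntactic guards; skeleton v3.3 l. 60 and l. 67) -/

example
    (hM : ∀ C : ChernCharacterBetti, Markman2025_secantQuotient_twistedCarrier_onJacobian_pinned C
      (fun n X₀ I E => Summit.Ventures.HSemireg.gluableSigmaAdmissible n X₀ I E ∨
        Literature.AlgebraicGeometry.HodgeTheory.bfSingleAdmissible' n X₀ I E))
    (hG1 : ∀ C : ChernCharacterBetti, SecantQuotientAnchorLevelTransfer63PinnedPrime C)
    (hG1flat : ∀ C : ChernCharacterBetti, SecantQuotientPinnedAnchorLevelTransfer63PinnedPrime C)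
    (hG3 : ∀ C : ChernCharacterBetti, SecantQuotientSameAnchorTransfer63PinnedPrime C)
    (hE : ∀ C : ChernCharacterBetti, EllipticPowerExceptionalCarriersAt63TwPrime C)
    (hR : ∀ C : ChernCharacterBetti, LefAtExceptionalRegimeAtUnder (Literature.AlgebraicGeometry.HodgeTheory.twistedReflexiveClass C
        (fun n X₀ I E => Summit.Ventures.HSemireg.gluableSigmaAdmissible n X₀ I E ∨
          Literature.AlgebraicGeometry.HodgeTheory.bfSingleAdmissible' n X₀ I E)) 6 3
      (fun _ S f W ↦ ¬ HasServedFibre 6 3 (fun X θ ↦ secantQuotientAnchorsPinned X θ)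
          (fun X θ ↦ secantQuotientServedClassesPinned X θ) f W ∧
        ¬ ∃ (t : ComplexPoints S) (A₀ E₀ : AbelianVariety ℂ) (N : ℕ),
          A₀.dim = 6 ∧ E₀.dim = 1 ∧ A₀.IsIsogenous (E₀.powSucc N) ∧ Nonempty (A₀.X ≅ fiberOver f t))) : True := by
  have h2a := forall_secantQuotientAnchorCarrier63PinnedPrime_of_pinned_of_levelTransfer63_of_sameAnchorTransfer63 hM hG1 hG3
  guard_hyp h2a :ₛ ∀ C : ChernCharacterBetti, SecantQuotientAnchorCarrier63PinnedPrime C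
  have h2a' : ∀ C : ChernCharacterBetti, SecantQuotientAnchorCarrier63PinnedPrime C :=
    fun C => secantQuotientAnchorCarrier63PinnedPrime_of_pinned_of_pinnedLevelTransfer_of_sameAnchor (hM C) (hG1flat C) (hG3 C)
  have h2b := forall_secantQuotientResidual63PinnedPrime_of_ellipticPowerExceptionalCarriersAt63_of_under_not_not hE hR
  guard_hyp h2b :ₛ ∀ C : ChernCharacterBetti, SecantQuotientResidual63PinnedPrime C
  trivial

/-! ## §2 the primed `(6,3)` rung from the five named ∕ displayed `(6,3)` inputs, by the skeleton's own rung glue (p547560) -/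

/-- **THE PRIMED `(6,3)` RUNG FROM L1″, G1′, G3′, THE W-RESTRICTED CARRIERS AND THE DOUBLY RESIDUAL** — `L1″(·, AdmTw′) → G1′ → G3′ → W-carriers →
doubly residual ⟹ LefAtExceptionalRegimeSixfoldMiddle (tw C AdmTw′)` for every `C`, via ring2-b03x's junction
`forall_secantQuotientAnchorCarrier63PinnedPrime_of_pinned_of_levelTransfer63_of_sameAnchorTransfer63` (= stub 2a‴'s type), ring2-b03's
`forall_secantQuotientResidual63PinnedPrime_of_ellipticPowerExceptionalCarriersAt63_of_under_not_not` (= stub 2b‴'s type) and the skeleton's rung glue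
`rung_sixfoldMiddleTwPrime_of_secantQuotientAnchorCarrier63PinnedPrime_of_residual63PinnedPrime`. Fact-free; every input is a hypothesis.
[cite: Markman2025SecantWeil, Thm. 1.4.1 and §1.5] -/
theorem rung63_of_pinned_of_G1_of_G3_of_W_of_doublyResidual
    (hM : ∀ C : ChernCharacterBetti, Markman2025_secantQuotient_twistedCarrier_onJacobian_pinned C
      (fun n X₀ I E => Summit.Ventures.HSemireg.gluableSigmaAdmissible n X₀ I E ∨
        Literature.AlgebraicGeometry.HodgeTheory.bfSingleAdmissible' n X₀ I E))
    (hG1 : ∀ C : ChernCharacterBetti, SecantQuotientAnchorLevelTransfer63PinnedPrime C)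
    (hG3 : ∀ C : ChernCharacterBetti, SecantQuotientSameAnchorTransfer63PinnedPrime C)
    (hE : ∀ C : ChernCharacterBetti, EllipticPowerExceptionalCarriersAt63TwPrime C)
    (hR : ∀ C : ChernCharacterBetti, LefAtExceptionalRegimeAtUnder (Literature.AlgebraicGeometry.HodgeTheory.twistedReflexiveClass C
        (fun n X₀ I E => Summit.Ventures.HSemireg.gluableSigmaAdmissible n X₀ I E ∨
          Literature.AlgebraicGeometry.HodgeTheory.bfSingleAdmissible' n X₀ I E)) 6 3
      (fun _ S f W ↦ ¬ HasServedFibre 6 3 (fun X θ ↦ secantQuotientAnchorsPinned X θ)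
          (fun X θ ↦ secantQuotientServedClassesPinned X θ) f W ∧
        ¬ ∃ (t : ComplexPoints S) (A₀ E₀ : AbelianVariety ℂ) (N : ℕ),
          A₀.dim = 6 ∧ E₀.dim = 1 ∧ A₀.IsIsogenous (E₀.powSucc N) ∧ Nonempty (A₀.X ≅ fiberOver f t))) :
    ∀ C : ChernCharacterBetti, LefAtExceptionalRegimeSixfoldMiddle (Literature.AlgebraicGeometry.HodgeTheory.twistedReflexiveClass C
      (fun n X₀ I E => Summit.Ventures.HSemireg.gluableSigmaAdmissible n X₀ I E ∨
        Literature.AlgebraicGeometry.HodgeTheory.bfSingleAdmissible' n X₀ I E)) :=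
  rung_sixfoldMiddleTwPrime_of_secantQuotientAnchorCarrier63PinnedPrime_of_residual63PinnedPrime
    (forall_secantQuotientAnchorCarrier63PinnedPrime_of_pinned_of_levelTransfer63_of_sameAnchorTransfer63 hM hG1 hG3)
    (forall_secantQuotientResidual63PinnedPrime_of_ellipticPowerExceptionalCarriersAt63_of_under_not_not hE hR)

/-- **THE PRIMED `(6,3)` RUNG, G1♭ FORM** — the same composition with lane R's pinned-target node G1♭′ = `SecantQuotientPinnedAnchorLevelTransfer63PinnedPrime C`
(ring2-b03 g87, p566937) in place of G1′, through the junction `secantQuotientAnchorCarrier63PinnedPrime_of_pinned_of_pinnedLevelTransfer_of_sameAnchor`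
(stub 2a‴ ⟸ L1″ ∧ G1♭′ ∧ G3′, no side hypothesis). Fact-free; every input is a hypothesis. [cite: Markman2025SecantWeil, Thm. 1.4.1 and §1.5] -/
theorem rung63_of_pinned_of_G1flat_of_G3_of_W_of_doublyResidual
    (hM : ∀ C : ChernCharacterBetti, Markman2025_secantQuotient_twistedCarrier_onJacobian_pinned C
      (fun n X₀ I E => Summit.Ventures.HSemireg.gluableSigmaAdmissible n X₀ I E ∨
        Literature.AlgebraicGeometry.HodgeTheory.bfSingleAdmissible' n X₀ I E))
    (hG1 : ∀ C : ChernCharacterBetti, SecantQuotientPinnedAnchorLevelTransfer63PinnedPrime C)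
    (hG3 : ∀ C : ChernCharacterBetti, SecantQuotientSameAnchorTransfer63PinnedPrime C)
    (hE : ∀ C : ChernCharacterBetti, EllipticPowerExceptionalCarriersAt63TwPrime C)
    (hR : ∀ C : ChernCharacterBetti, LefAtExceptionalRegimeAtUnder (Literature.AlgebraicGeometry.HodgeTheory.twistedReflexiveClass C
        (fun n X₀ I E => Summit.Ventures.HSemireg.gluableSigmaAdmissible n X₀ I E ∨
          Literature.AlgebraicGeometry.HodgeTheory.bfSingleAdmissible' n X₀ I E)) 6 3
      (fun _ S f W ↦ ¬ HasServedFibre 6 3 (fun X θ ↦ secantQuotientAnchorsPinned X θ)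
          (fun X θ ↦ secantQuotientServedClassesPinned X θ) f W ∧
        ¬ ∃ (t : ComplexPoints S) (A₀ E₀ : AbelianVariety ℂ) (N : ℕ),
          A₀.dim = 6 ∧ E₀.dim = 1 ∧ A₀.IsIsogenous (E₀.powSucc N) ∧ Nonempty (A₀.X ≅ fiberOver f t))) :
    ∀ C : ChernCharacterBetti, LefAtExceptionalRegimeSixfoldMiddle (Literature.AlgebraicGeometry.HodgeTheory.twistedReflexiveClass C
      (fun n X₀ I E => Summit.Ventures.HSemireg.gluableSigmaAdmissible n X₀ I E ∨
        Literature.AlgebraicGeometry.HodgeTheory.bfSingleAdmissible' n X₀ I E)) :=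
  rung_sixfoldMiddleTwPrime_of_secantQuotientAnchorCarrier63PinnedPrime_of_residual63PinnedPrime
    (fun C => secantQuotientAnchorCarrier63PinnedPrime_of_pinned_of_pinnedLevelTransfer_of_sameAnchor (hM C) (hG1 C) (hG3 C))
    (forall_secantQuotientResidual63PinnedPrime_of_ellipticPowerExceptionalCarriersAt63_of_under_not_not hE hR)

/-! ## §3 SEVEN INPUTS ⟹ THE ROUTE DECL BY NAME (stubs 1′ ∕ 3′ displayed; no sorry anywhere) -/

/-- **SEVEN NAMED ∕ DISPLAYED INPUTS GIVE THE PRIMED DIAGONAL CRUX BY NAME**: stub 1′ (regime 2 over `tw(C, AdmTw′)` at `(4,2)`, displayed) →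
L1″(C, AdmTw′) (`Markman2025_secantQuotient_twistedCarrier_onJacobian_pinned`, print, preprint-gated) → G1′ (`SecantQuotientAnchorLevelTransfer63PinnedPrime`,
lane R node) → G3′ (`SecantQuotientSameAnchorTransfer63PinnedPrime`, lane W1 node) → W-restricted elliptic-power carriers
(`EllipticPowerExceptionalCarriersAt63TwPrime`) → the doubly residual (displayed) → stub 3′ (the tail `4 ≤ m`, displayed) ⟹
`Theses.VHCAbelianSchemesRoad.SemiregularSheafRepresentativesTwPrimeAtDiag` — the ROUTE DECL of item stmt-HodgeConjecture-20707 BY NAME. The conclusion carries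
all seven inputs as hypotheses: this CLOSES NOTHING and asserts none of them. [cite: Markman2025SecantWeil, Thm. 1.4.1 and §1.5] [cite: Bloch1972Semiregularity, Remark (7.5)] -/
theorem cruxDecl_of_firstCell_of_pinned_of_G1_of_G3_of_W_of_doublyResidual_of_tail
    (h₁ : ∀ C : ChernCharacterBetti,
      LefAtExceptionalRegimeAt (Literature.AlgebraicGeometry.HodgeTheory.twistedReflexiveClass C (fun n X₀ I E => Summit.Ventures.HSemireg.gluableSigmaAdmissible n X₀ I E ∨ Literature.AlgebraicGeometry.HodgeTheory.bfSingleAdmissible' n X₀ I E)) 4 2)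
    (hM : ∀ C : ChernCharacterBetti, Markman2025_secantQuotient_twistedCarrier_onJacobian_pinned C
      (fun n X₀ I E => Summit.Ventures.HSemireg.gluableSigmaAdmissible n X₀ I E ∨
        Literature.AlgebraicGeometry.HodgeTheory.bfSingleAdmissible' n X₀ I E))
    (hG1 : ∀ C : ChernCharacterBetti, SecantQuotientAnchorLevelTransfer63PinnedPrime C)
    (hG3 : ∀ C : ChernCharacterBetti, SecantQuotientSameAnchorTransfer63PinnedPrime C)
    (hE : ∀ C : ChernCharacterBetti, EllipticPowerExceptionalCarriersAt63TwPrime C)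
    (hR : ∀ C : ChernCharacterBetti, LefAtExceptionalRegimeAtUnder (Literature.AlgebraicGeometry.HodgeTheory.twistedReflexiveClass C
        (fun n X₀ I E => Summit.Ventures.HSemireg.gluableSigmaAdmissible n X₀ I E ∨
          Literature.AlgebraicGeometry.HodgeTheory.bfSingleAdmissible' n X₀ I E)) 6 3
      (fun _ S f W ↦ ¬ HasServedFibre 6 3 (fun X θ ↦ secantQuotientAnchorsPinned X θ)
          (fun X θ ↦ secantQuotientServedClassesPinned X θ) f W ∧
        ¬ ∃ (t : ComplexPoints S) (A₀ E₀ : AbelianVariety ℂ) (N : ℕ),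
          A₀.dim = 6 ∧ E₀.dim = 1 ∧ A₀.IsIsogenous (E₀.powSucc N) ∧ Nonempty (A₀.X ≅ fiberOver f t)))
    (h₃ : ∀ (C : ChernCharacterBetti) (m : ℕ), 4 ≤ m →
      LefAtExceptionalRegimeAt (Literature.AlgebraicGeometry.HodgeTheory.twistedReflexiveClass C (fun n X₀ I E => Summit.Ventures.HSemireg.gluableSigmaAdmissible n X₀ I E ∨ Literature.AlgebraicGeometry.HodgeTheory.bfSingleAdmissible' n X₀ I E)) (2 * m) m) :
    Summit.HodgeConjecture.HodgeConjecture.Theses.VHCAbelianSchemesRoad.SemiregularSheafRepresentativesTwPrimeAtDiag :=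
  twPrimeAtDiag_of_cells h₁ (rung63_of_pinned_of_G1_of_G3_of_W_of_doublyResidual hM hG1 hG3 hE hR) h₃

/-- **SEVEN NAMED ∕ DISPLAYED INPUTS GIVE THE PRIMED DIAGONAL CRUX BY NAME, G1♭ FORM**: as `cruxDecl_of_firstCell_of_pinned_of_G1_of_G3_of_W_of_doublyResidual_of_tail`
with lane R's pinned-target node G1♭′ = `SecantQuotientPinnedAnchorLevelTransfer63PinnedPrime C` (p566937) in place of G1′. Closes nothing; every input is a
hypothesis. [cite: Markman2025SecantWeil, Thm. 1.4.1 and §1.5] [cite: Bloch1972Semiregularity, Remark (7.5)] -/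
theorem cruxDecl_of_firstCell_of_pinned_of_G1flat_of_G3_of_W_of_doublyResidual_of_tail
    (h₁ : ∀ C : ChernCharacterBetti,
      LefAtExceptionalRegimeAt (Literature.AlgebraicGeometry.HodgeTheory.twistedReflexiveClass C (fun n X₀ I E => Summit.Ventures.HSemireg.gluableSigmaAdmissible n X₀ I E ∨ Literature.AlgebraicGeometry.HodgeTheory.bfSingleAdmissible' n X₀ I E)) 4 2)
    (hM : ∀ C : ChernCharacterBetti, Markman2025_secantQuotient_twistedCarrier_onJacobian_pinned C
      (fun n X₀ I E => Summit.Ventures.HSemireg.gluableSigmaAdmissible n X₀ I E ∨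
        Literature.AlgebraicGeometry.HodgeTheory.bfSingleAdmissible' n X₀ I E))
    (hG1 : ∀ C : ChernCharacterBetti, SecantQuotientPinnedAnchorLevelTransfer63PinnedPrime C)
    (hG3 : ∀ C : ChernCharacterBetti, SecantQuotientSameAnchorTransfer63PinnedPrime C)
    (hE : ∀ C : ChernCharacterBetti, EllipticPowerExceptionalCarriersAt63TwPrime C)
    (hR : ∀ C : ChernCharacterBetti, LefAtExceptionalRegimeAtUnder (Literature.AlgebraicGeometry.HodgeTheory.twistedReflexiveClass C
        (fun n X₀ I E => Summit.Ventures.HSemireg.gluableSigmaAdmissible n X₀ I E ∨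
          Literature.AlgebraicGeometry.HodgeTheory.bfSingleAdmissible' n X₀ I E)) 6 3
      (fun _ S f W ↦ ¬ HasServedFibre 6 3 (fun X θ ↦ secantQuotientAnchorsPinned X θ)
          (fun X θ ↦ secantQuotientServedClassesPinned X θ) f W ∧
        ¬ ∃ (t : ComplexPoints S) (A₀ E₀ : AbelianVariety ℂ) (N : ℕ),
          A₀.dim = 6 ∧ E₀.dim = 1 ∧ A₀.IsIsogenous (E₀.powSucc N) ∧ Nonempty (A₀.X ≅ fiberOver f t)))
    (h₃ : ∀ (C : ChernCharacterBetti) (m : ℕ), 4 ≤ m →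
      LefAtExceptionalRegimeAt (Literature.AlgebraicGeometry.HodgeTheory.twistedReflexiveClass C (fun n X₀ I E => Summit.Ventures.HSemireg.gluableSigmaAdmissible n X₀ I E ∨ Literature.AlgebraicGeometry.HodgeTheory.bfSingleAdmissible' n X₀ I E)) (2 * m) m) :
    Summit.HodgeConjecture.HodgeConjecture.Theses.VHCAbelianSchemesRoad.SemiregularSheafRepresentativesTwPrimeAtDiag :=
  twPrimeAtDiag_of_cells h₁ (rung63_of_pinned_of_G1flat_of_G3_of_W_of_doublyResidual hM hG1 hG3 hE hR) h₃

end Summit.HodgeConjecture.HodgeConjecture.Ring2.SemiregularRepresentatives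

end
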